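import Mathlib

/-!
# An orbit-counting inequality for equivariant matrices with orthogonal rows (Bessel–Burnside; kernel, general)

Framing: lottery ticket; floor = certified bounds/negative ranges.

Cell pub-namedobj (venture DiscreteObjects), target (H), hadamard gen 11.  A general lemma used by the
composite-order exclusions for automorphisms of a Hadamard matrix of order 668 (`CompositeOrder23`).

Let `M : R × X → ℤ` have pairwise orthogonal rows of squared norm `c > 0` (`M Mᵀ = c·I`), and let
permutations `α` of `R` and `β` of `X` with `α^n = β^n = 1` act compatibly: `M (α u) (β j) = M u j`.  Then
`∑_{m<n} #{u | α^m u = u} ≤ ∑_{m<n} #{j | β^m j = j}`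
(`sum_card_fixed_le`), i.e. (Burnside) the cyclic group has at most as many orbits on the rows as on the
columns.  Proof, entirely by finite sums: Bessel's inequality `|M s|² ≤ c |s|²` (`bessel_of_mul_transpose`:
`c (c|s|² − |M s|²) = |c s − Mᵀ M s|² ≥ 0`) applied to the `|X|` vectors `s_j = ∑_{k<n} e_{β^k j}` and summed
over `j`; the two sides evaluate to `n c ∑_m #fix(α^m)` and `n c ∑_m #fix(β^m)` after the re-indexing
`l = m + k` in `ℤ/n` and `x = β^k j`.  No representation theory, no orbit decomposition.
Ours (elementary), not literature; no `sorry`.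
-/

namespace Summit.Ventures.DiscreteObjects.Hadamard

open Finset BigOperators Matrix

section bessel
variable {R X : Type*} [Fintype R] [DecidableEq R] [Fintype X] [DecidableEq X]

omit [DecidableEq X] in
/-- **Bessel's inequality** for an integer matrix with pairwise orthogonal rows of squared norm `c > 0`:
`|M s|² ≤ c |s|²` for every integer vector `s`. -/
theorem bessel_of_mul_transpose (M : Matrix R X ℤ) {c : ℤ} (hc : 0 < c)
    (hM : M * Mᵀ = c • (1 : Matrix R R ℤ)) (s : X → ℤ) :
    (M *ᵥ s) ⬝ᵥ (M *ᵥ s) ≤ c * (s ⬝ᵥ s) := by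
  set y := M *ᵥ s with hy
  set z := Mᵀ *ᵥ y with hz
  have h1 : s ⬝ᵥ z = y ⬝ᵥ y := by
    rw [hz, dotProduct_mulVec, vecMul_transpose]
  have h2 : z ⬝ᵥ z = c * (y ⬝ᵥ y) := by
    calc z ⬝ᵥ z = (Mᵀ *ᵥ y) ⬝ᵥ (Mᵀ *ᵥ y) := rfl
      _ = (y ᵥ* M) ⬝ᵥ (Mᵀ *ᵥ y) := by rw [mulVec_transpose]
      _ = y ⬝ᵥ (M *ᵥ (Mᵀ *ᵥ y)) := by rw [← dotProduct_mulVec]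
      _ = y ⬝ᵥ ((M * Mᵀ) *ᵥ y) := by rw [mulVec_mulVec]
      _ = y ⬝ᵥ (c • y) := by rw [hM, smul_mulVec, one_mulVec]
      _ = c * (y ⬝ᵥ y) := by rw [dotProduct_smul, smul_eq_mul]
  have h3 : (c • s - z) ⬝ᵥ (c • s - z) = c * (c * (s ⬝ᵥ s) - y ⬝ᵥ y) := by
    simp only [sub_dotProduct, dotProduct_sub, smul_dotProduct, dotProduct_smul, smul_eq_mul]
    rw [h1, dotProduct_comm z s, h1, h2]
    ring
  have h4 : 0 ≤ (c • s - z) ⬝ᵥ (c • s - z) :=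
    Finset.sum_nonneg (fun j _ => mul_self_nonneg _)
  rw [h3] at h4
  have h5 : 0 ≤ c * (s ⬝ᵥ s) - y ⬝ᵥ y := (mul_nonneg_iff_of_pos_left hc).mp h4
  linarith

omit [Fintype R] [DecidableEq X] in
/-- rows of `M` are orthogonal with squared norm `c`: `∑_j M a j * M b j = c · [a = b]` -/
lemma row_dot_of_mul_transpose (M : Matrix R X ℤ) {c : ℤ} (hM : M * Mᵀ = c • (1 : Matrix R R ℤ)) (a b : R) :
    ∑ j, M a j * M b j = if a = b then c else 0 := by
  have e := congrFun (congrFun hM a) b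
  rw [Matrix.mul_apply, Matrix.smul_apply, smul_eq_mul] at e
  simp only [Matrix.transpose_apply] at e
  rw [e, Matrix.one_apply]
  split_ifs <;> simp

end bessel

section counting
variable {Y : Type*} [Fintype Y] [DecidableEq Y] {n : ℕ} [NeZero n]

omit [Fintype Y] [DecidableEq Y] [NeZero n] in
/-- powers indexed by `Fin n` add when `γ ^ n = 1` -/
lemma pow_fin_add (γ : Equiv.Perm Y) (hγ : γ ^ n = 1) (m k : Fin n) :
    γ ^ (m + k).val = γ ^ m.val * γ ^ k.val := by
  rw [Fin.val_add, ← pow_eq_pow_mod _ hγ, pow_add]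

/-- re-indexing a sum over `Fin n` by `l = m + k` -/
lemma sum_fin_shift (k : Fin n) (g : Fin n → ℤ) : ∑ l, g l = ∑ m, g (m + k) :=
  (Fintype.sum_equiv (Equiv.addRight k) (fun m => g (m + k)) g (fun _ => rfl)).symm

/-- counting `{x | γ^k x = γ^m (γ^k x)}` is counting the fixed points of `γ^m` -/
lemma card_filter_pow_shift (γ : Equiv.Perm Y) (k m : ℕ) :
    (univ.filter fun x => (γ ^ k) x = (γ ^ m) ((γ ^ k) x)).card = (univ.filter fun x => (γ ^ m) x = x).card := by
  rw [← Fintype.card_subtype, ← Fintype.card_subtype]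
  refine Fintype.card_congr (Equiv.subtypeEquiv (γ ^ k) (fun x => ?_))
  constructor
  · intro h; exact h.symm
  · intro h; exact h.symm

end counting

section main
variable {R X : Type*} [Fintype R] [DecidableEq R] [Fintype X] [DecidableEq X]

omit [Fintype R] [DecidableEq R] [Fintype X] [DecidableEq X] in
/-- iterated compatibility -/
lemma equivariant_pow (M : Matrix R X ℤ) (α : Equiv.Perm R) (β : Equiv.Perm X)
    (heq : ∀ u j, M (α u) (β j) = M u j) (k : ℕ) (u : R) (j : X) :
    M ((α ^ k) u) ((β ^ k) j) = M u j := by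
  induction k generalizing u j with
  | zero => simp
  | succ k ih => rw [pow_succ', pow_succ', Equiv.Perm.mul_apply, Equiv.Perm.mul_apply, heq, ih]

omit [Fintype R] [DecidableEq R] [Fintype X] [DecidableEq X] in
/-- moving a power of `β` across: `M u (β^k j) = M ((α^k)⁻¹ u) j` -/
lemma equivariant_symm (M : Matrix R X ℤ) (α : Equiv.Perm R) (β : Equiv.Perm X)
    (heq : ∀ u j, M (α u) (β j) = M u j) (k : ℕ) (u : R) (j : X) :
    M u ((β ^ k) j) = M ((α ^ k).symm u) j := by
  conv_lhs => rw [← (α ^ k).apply_symm_apply u]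
  exact equivariant_pow M α β heq k _ j

omit [DecidableEq X] in
/-- the correlation sum `∑_u ∑_x M u x * M u (β^m x)` equals `c · #fix(α^m)` -/
lemma corr_eq_card_fixed (M : Matrix R X ℤ) {c : ℤ} (hM : M * Mᵀ = c • (1 : Matrix R R ℤ))
    (α : Equiv.Perm R) (β : Equiv.Perm X) (heq : ∀ u j, M (α u) (β j) = M u j) (m : ℕ) :
    ∑ u, ∑ x, M u x * M u ((β ^ m) x) = c * (univ.filter fun u => (α ^ m) u = u).card := by
  have key : ∀ u, ∑ x, M u x * M u ((β ^ m) x) = if u = (α ^ m).symm u then c else 0 := by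
    intro u
    rw [Finset.sum_congr rfl fun x _ => by rw [equivariant_symm M α β heq m u x]]
    exact row_dot_of_mul_transpose M hM u ((α ^ m).symm u)
  have hf : (univ.filter fun u => u = (α ^ m).symm u) = univ.filter fun u => (α ^ m) u = u := by
    apply Finset.filter_congr
    intro u _
    rw [eq_comm, Equiv.symm_apply_eq, eq_comm]
  rw [Finset.sum_congr rfl fun u _ => key u, Finset.sum_ite, Finset.sum_const_zero, add_zero,
    Finset.sum_const, nsmul_eq_mul, mul_comm, hf]

omit [Fintype R] [DecidableEq R] in
/-- `(M s_j) u = ∑_k M u (β^k j)` -/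
lemma mulVec_testVec (M : Matrix R X ℤ) (β : Equiv.Perm X) (n : ℕ) (j : X) (u : R) :
    (M *ᵥ (fun x => ∑ k : Fin n, if (β ^ k.val) j = x then (1 : ℤ) else 0)) u = ∑ k : Fin n, M u ((β ^ k.val) j) := by
  simp only [Matrix.mulVec, dotProduct, Finset.mul_sum]
  rw [Finset.sum_comm]
  apply Finset.sum_congr rfl
  intro k _
  simp only [mul_ite, mul_one, mul_zero]
  rw [Finset.sum_ite_eq]
  simp

/-- `s_j · s_j = ∑_k ∑_l [β^k j = β^l j]` -/
lemma testVec_dot (β : Equiv.Perm X) (n : ℕ) (j : X) :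
    (fun x => ∑ k : Fin n, if (β ^ k.val) j = x then (1 : ℤ) else 0) ⬝ᵥ (fun x => ∑ k : Fin n, if (β ^ k.val) j = x then (1 : ℤ) else 0)
      = ∑ k : Fin n, ∑ l : Fin n, if (β ^ k.val) j = (β ^ l.val) j then (1 : ℤ) else 0 := by
  simp only [dotProduct, Finset.sum_mul_sum]
  rw [Finset.sum_comm]
  apply Finset.sum_congr rfl
  intro k _
  rw [Finset.sum_comm]
  apply Finset.sum_congr rfl
  intro l _
  simp only [ite_mul, one_mul, zero_mul]
  rw [Finset.sum_ite_eq]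
  simp only [Finset.mem_univ, if_true]
  by_cases h : (β ^ k.val) j = (β ^ l.val) j
  · rw [if_pos h, if_pos h.symm]
  · rw [if_neg h, if_neg (fun h' => h h'.symm)]

variable {n : ℕ} [NeZero n]

/-- column side: `∑_j s_j · s_j = n · ∑_m #fix(β^m)` -/
lemma sum_testVec_dot (β : Equiv.Perm X) (hβ : β ^ n = 1) :
    ∑ j, (fun x => ∑ k : Fin n, if (β ^ k.val) j = x then (1 : ℤ) else 0) ⬝ᵥ (fun x => ∑ k : Fin n, if (β ^ k.val) j = x then (1 : ℤ) else 0) = n * ∑ m : Fin n, ((univ.filter fun x => (β ^ m.val) x = x).card : ℤ) := by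
  rw [Finset.sum_congr rfl fun j _ => testVec_dot β n j, Finset.sum_comm]
  -- for each k the inner double sum is ∑_m #fix(β^m)
  have inner : ∀ k : Fin n, ∑ j, ∑ l : Fin n, (if (β ^ k.val) j = (β ^ l.val) j then (1 : ℤ) else 0)
      = ∑ m : Fin n, ((univ.filter fun x => (β ^ m.val) x = x).card : ℤ) := by
    intro k
    rw [Finset.sum_comm]
    rw [sum_fin_shift k]
    apply Finset.sum_congr rfl
    intro m _
    rw [Finset.sum_boole, ← card_filter_pow_shift β k.val m.val]
    congr 2
    apply Finset.filter_congr
    intro x _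
    rw [pow_fin_add β hβ m k, Equiv.Perm.mul_apply]
  rw [Finset.sum_congr rfl fun k _ => inner k, Finset.sum_const, Finset.card_univ, Fintype.card_fin,
    nsmul_eq_mul]

/-- row side: `∑_j (M s_j) · (M s_j) = n · c · ∑_m #fix(α^m)` -/
lemma sum_mulVec_testVec_dot (M : Matrix R X ℤ) {c : ℤ} (hM : M * Mᵀ = c • (1 : Matrix R R ℤ))
    (α : Equiv.Perm R) (β : Equiv.Perm X) (hβ : β ^ n = 1) (heq : ∀ u j, M (α u) (β j) = M u j) :
    ∑ j, (M *ᵥ (fun x => ∑ k : Fin n, if (β ^ k.val) j = x then (1 : ℤ) else 0)) ⬝ᵥ (M *ᵥ (fun x => ∑ k : Fin n, if (β ^ k.val) j = x then (1 : ℤ) else 0))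
      = n * (c * ∑ m : Fin n, ((univ.filter fun u => (α ^ m.val) u = u).card : ℤ)) := by
  -- expand
  have expand : ∀ j, (M *ᵥ (fun x => ∑ k : Fin n, if (β ^ k.val) j = x then (1 : ℤ) else 0)) ⬝ᵥ (M *ᵥ (fun x => ∑ k : Fin n, if (β ^ k.val) j = x then (1 : ℤ) else 0))
      = ∑ k : Fin n, ∑ l : Fin n, ∑ u, M u ((β ^ k.val) j) * M u ((β ^ l.val) j) := by
    intro j
    simp only [dotProduct, mulVec_testVec, Finset.sum_mul_sum]
    rw [Finset.sum_comm]
    apply Finset.sum_congr rfl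
    intro k _
    rw [Finset.sum_comm]
  rw [Finset.sum_congr rfl fun j _ => expand j, Finset.sum_comm]
  have inner : ∀ k : Fin n, ∑ j, ∑ l : Fin n, ∑ u, M u ((β ^ k.val) j) * M u ((β ^ l.val) j)
      = c * ∑ m : Fin n, ((univ.filter fun u => (α ^ m.val) u = u).card : ℤ) := by
    intro k
    rw [Finset.sum_comm, sum_fin_shift k, Finset.mul_sum]
    apply Finset.sum_congr rfl
    intro m _
    rw [← corr_eq_card_fixed M hM α β heq m.val, Finset.sum_comm]
    -- reindex x = β^k j
    rw [show ∑ u, ∑ x, M u x * M u ((β ^ m.val) x)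
        = ∑ u, ∑ j, M u ((β ^ k.val) j) * M u ((β ^ m.val) ((β ^ k.val) j)) from
      Finset.sum_congr rfl fun u _ =>
        (Equiv.sum_comp (β ^ k.val) (fun x => M u x * M u ((β ^ m.val) x))).symm]
    apply Finset.sum_congr rfl
    intro u _
    apply Finset.sum_congr rfl
    intro j _
    rw [pow_fin_add β hβ m k, Equiv.Perm.mul_apply]
  rw [Finset.sum_congr rfl fun k _ => inner k, Finset.sum_const, Finset.card_univ, Fintype.card_fin,
    nsmul_eq_mul]

/-- **Orbit-counting inequality (Bessel–Burnside).**  If `M Mᵀ = c·I` with `c > 0` and the permutations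
`α` (rows), `β` (columns) with `α^n = β^n = 1` act compatibly on `M`, then
`∑_{m<n} #{u | α^m u = u} ≤ ∑_{m<n} #{j | β^m j = j}`. -/
theorem sum_card_fixed_le (M : Matrix R X ℤ) {c : ℤ} (hc : 0 < c) (hM : M * Mᵀ = c • (1 : Matrix R R ℤ))
    (α : Equiv.Perm R) (β : Equiv.Perm X) (hα : α ^ n = 1) (hβ : β ^ n = 1)
    (heq : ∀ u j, M (α u) (β j) = M u j) :
    ∑ m : Fin n, ((univ.filter fun u => (α ^ m.val) u = u).card : ℤ)
      ≤ ∑ m : Fin n, ((univ.filter fun j => (β ^ m.val) j = j).card : ℤ) := by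
  have _ := hα
  have hB : ∑ j, (M *ᵥ (fun x => ∑ k : Fin n, if (β ^ k.val) j = x then (1 : ℤ) else 0)) ⬝ᵥ (M *ᵥ (fun x => ∑ k : Fin n, if (β ^ k.val) j = x then (1 : ℤ) else 0)) ≤ ∑ j, c * ((fun x => ∑ k : Fin n, if (β ^ k.val) j = x then (1 : ℤ) else 0) ⬝ᵥ (fun x => ∑ k : Fin n, if (β ^ k.val) j = x then (1 : ℤ) else 0)) :=
    Finset.sum_le_sum fun j _ => bessel_of_mul_transpose M hc hM _
  rw [sum_mulVec_testVec_dot M hM α β hβ heq, ← Finset.mul_sum, sum_testVec_dot β hβ] at hB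
  have hn : (0 : ℤ) < n := by exact_mod_cast Nat.pos_of_ne_zero (NeZero.ne n)
  have hnc : (0 : ℤ) < n * c := mul_pos hn hc
  have e : (n : ℤ) * (c * ∑ m : Fin n, ((univ.filter fun u => (α ^ m.val) u = u).card : ℤ))
      = (n * c) * ∑ m : Fin n, ((univ.filter fun u => (α ^ m.val) u = u).card : ℤ) := by ring
  have e' : c * ((n : ℤ) * ∑ m : Fin n, ((univ.filter fun x => (β ^ m.val) x = x).card : ℤ))
      = (n * c) * ∑ m : Fin n, ((univ.filter fun x => (β ^ m.val) x = x).card : ℤ) := by ring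
  rw [e, e'] at hB
  exact le_of_mul_le_mul_left hB hnc

end main

end Summit.Ventures.DiscreteObjects.Hadamard
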